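import Summits.ValiantsHypothesis.ValiantsHypothesis.Theorems.LacunarySymmetroidMatrixDescartesSeparatedWindowRay
import Summits.ValiantsHypothesis.ValiantsHypothesis.Theorems.LacunarySymmetroidMatrixDescartesSeparatedWindowOrders

/-!
# `MatrixDescartes` — the LETTER-SEPARATED WINDOW LAW (structural form): one hand-over of dominance between two
# letters of a real lacunary pencil carries at most `m` real zeros, for ARBITRARY letters

HONEST FRAMING.  Object-search cell `pub-symmetroid`, crux `Theses.LacunarySymmetroid.MatrixDescartes`
(ledger item `stmt-ValiantsHypothesis-18050`, route `LacunarySymmetroid`; seat `val-sym-mdr-p2`, gen 12).  The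
crux implies `VP ≠ VNP` by the route's assembly; NOTHING here is progress on it and nothing here is a claim
about `VP ≠ VNP`, `DoorA26` / `DoorA34` or the cell's registers.

**THE LAW** (`card_realRoots_window_le_of_separated`).  `F = ∑ₗ X^(d l) • S l`, real `m × m` letters with
`|S l i j| ≤ σ l` — no symmetry, rank, commutation or definiteness hypothesis; two letters `a, b` with
`d a < d b`; `E(x) = ∑_{l ≠ a,b} σ l·x^(d l)` (all OTHER letters), `M(x) = σ a·x^(d a) + σ b·x^(d b)`.  If on a
window `0 < u < v`
* `m!·m·(σ b·u^(d b) + E(u))·(M(u)+E(u))^(m−1) < |det S a|·u^(m·d a)`   (at `u` the letter `a` dominates),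
* `m!·m·(σ a·v^(d a) + E(v))·(M(v)+E(v))^(m−1) < |det S b|·v^(m·d b)`   (at `v` the letter `b` dominates),
* `(m+1)^m·m!·m·E(x)·(M(x)+E(x))^(m−1) < max (|det S a|·x^(m·d a)) (|det S b|·x^(m·d b))` for `x ∈ [u,v]`
  (inside, the other letters are small against the better of the two),
then `det F` has AT MOST `m` DISTINCT REAL ZEROS in `(u, v)`: the matrix Descartes count (the «diagonal»
column `m(K−1)` of the cell's Table S, one hand-over at a time) for a pencil whose letters hand over dominance
one pair at a time with a margin — «letter-separated», the matrix-level form of the near-tropical regime of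
`HOME/…/GAP-LIFT.md` §4 (S-near).  The hypotheses are polynomial inequalities in `x` and the letter data
(entry bounds, the two determinants); the margin they demand is `exp(O(m log m))` times the conditioning of the
two letters, i.e. a valuation gap of order `m log m` — the width of the ambiguity windows of GAP-LIFT §3 (M2).

PROOF.  Rouché on the rectangle `[log u, log v] × [−h, h]` in `t = log x` (kit I,
`finsum_order_eq_of_norm_sub_lt_rect`) against `Ψ(t) = det(e^(d a·t) S a + e^(d b·t) S b) = e^(m d a t)·p(e^(g t))`,
`p = det(S a + w S b)`, `g = d b − d a`: `h = θ/g` with `θ ∈ [δ, π − δ]`, `δ = π/(2(m+1))`, chosen `δ`-far from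
the arguments of the `m` roots of `p` (kit III, angular pigeonhole), so that on the horizontal sides
`|Ψ| ≥ (sin δ)^m·max(|det S a|x^(m d a), |det S b|x^(m d b)) ≥ (m+1)^(−m)·max(…)` (ray lower bound, Jordan);
on the vertical sides one letter dominates (Leibniz bound); `|det F(e^t) − Ψ(t)| ≤ m!·m·E·(M+E)^(m−1)`
everywhere.  `Ψ` has `≤ m` zeros with multiplicity in the strip `|Im t| < h ≤ π/g` (kit II), hence so does
`det F ∘ exp`, and every real zero `x ∈ (u,v)` of `det F` is the zero `log x` of the latter.

WHAT THIS IS NOT.  A theorem about separated configurations only: the cell's extremal census rows (γ-ladder,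
flags, grafts — clustered roots, near-null ends) violate every hypothesis here, as they must, since they exceed
`m(K−1)`.  The law locates where super-Descartes-with-multiplicity counts can come from: overlapping hand-overs
or ill-conditioned letters (small `|det|` against the entry size).  [folklore; Rouché / argument principle:
Conway, *Functions of One Complex Variable I*, V §3]
-/

-- `Summit.ValiantsHypothesis.ValiantsHypothesis.…` repeats a component by the D-0017 layout
-- (single-conjunct summit), which the `dupNamespace` linter flags; the name is mandated.
set_option linter.dupNamespace false

namespace Summit.ValiantsHypothesis.ValiantsHypothesis.Theorems.LacunarySymmetroidMatrixDescartes.Separated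

open Polynomial Complex Set Finset
open scoped BigOperators Matrix Real

/-! ## §8 The structural two-letter window law -/

section Window

variable {K m : ℕ} (d : Fin K → ℕ) (S : Fin K → Matrix (Fin m) (Fin m) ℝ) (σ : Fin K → ℝ)

/-- Jordan's inequality at `δ = π/(2(m+1))`: `(m+1)⁻¹ ≤ sin δ`, hence `((m+1)^m)⁻¹ ≤ (sin δ)^m`. [folklore] -/
theorem inv_pow_le_sin_pow (m : ℕ) :
    ((m + 1 : ℝ) ^ m)⁻¹ ≤ Real.sin (π / (2 * (m + 1))) ^ m := by
  have hm : (0 : ℝ) < m + 1 := by positivity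
  have h1 : (m + 1 : ℝ)⁻¹ ≤ Real.sin (π / (2 * (m + 1))) := by
    have h := Real.mul_le_sin (x := π / (2 * (m + 1))) (by positivity)
      (div_le_div_of_nonneg_left Real.pi_pos.le two_pos (by linarith))
    have e : 2 / π * (π / (2 * (m + 1))) = (m + 1 : ℝ)⁻¹ := by field_simp
    rwa [e] at h
  rw [← inv_pow]
  exact pow_le_pow_left₀ (by positivity) h1 m

/-- **THE LETTER-SEPARATED WINDOW LAW (structural form).**  Let `F = ∑ₗ X^(d l) • S l` be a real `m × m`
lacunary pencil with arbitrary letters, `|S l i j| ≤ σ l`, and let `a, b` be two letters with `d a < d b`.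
Write `E(x) = ∑_{l ≠ a, b} σ l·x^(d l)` (the other letters) and `M(x) = σ a·x^(d a) + σ b·x^(d b)`.  Suppose that
on a window `0 < u < v`:
* (left end, letter `a` dominates)  `m!·m·(σ b·u^(d b) + E(u))·(M(u) + E(u))^(m−1) < |det S a|·u^(m·d a)`,
* (right end, letter `b` dominates) `m!·m·(σ a·v^(d a) + E(v))·(M(v) + E(v))^(m−1) < |det S b|·v^(m·d b)`,
* (inside, the other letters are small) for all `x ∈ [u, v]`:
  `(m+1)^m·m!·m·E(x)·(M(x) + E(x))^(m−1) < max (|det S a|·x^(m·d a)) (|det S b|·x^(m·d b))`.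
Then `det F` has AT MOST `m` distinct real zeros in `(u, v)` — the matrix Descartes count for one hand-over of
dominance, for ARBITRARY (indefinite, non-commuting) letters.  Proof: Rouché on the rectangle
`[log u, log v] × [−h, h]` in `t = log x` against the two-letter determinant, with `g·h ∈ [δ, π−δ]`
(`δ = π/(2(m+1))`) chosen `δ`-far from the arguments of the `≤ m` roots of `det(S a + w S b)` (angular
pigeonhole), so that on the horizontal sides `|det(two letters)| ≥ (m+1)^(−m)·max(|det S a|x^(m d a), |det S b|x^(m d b))`;
the two-letter determinant has `≤ m` zeros with multiplicity in the strip (kit II). [folklore] -/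
theorem card_realRoots_window_le_of_separated (hσ : ∀ l i j, |S l i j| ≤ σ l) (hσ0 : ∀ l, 0 ≤ σ l)
    (a b : Fin K) (hab : d a < d b) {u v : ℝ} (hu : 0 < u) (huv : u < v)
    (hleft : (m.factorial : ℝ) * (m * (σ b * u ^ d b + ∑ l ∈ (Finset.univ.erase a).erase b, σ l * u ^ d l) *
        (σ a * u ^ d a + σ b * u ^ d b + ∑ l ∈ (Finset.univ.erase a).erase b, σ l * u ^ d l) ^ (m - 1)) <
      |(S a).det| * u ^ (m * d a))
    (hright : (m.factorial : ℝ) * (m * (σ a * v ^ d a + ∑ l ∈ (Finset.univ.erase a).erase b, σ l * v ^ d l) *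
        (σ a * v ^ d a + σ b * v ^ d b + ∑ l ∈ (Finset.univ.erase a).erase b, σ l * v ^ d l) ^ (m - 1)) <
      |(S b).det| * v ^ (m * d b))
    (hwin : ∀ x ∈ Set.Icc u v,
      ((m : ℝ) + 1) ^ m * ((m.factorial : ℝ) * (m * (∑ l ∈ (Finset.univ.erase a).erase b, σ l * x ^ d l) *
        (σ a * x ^ d a + σ b * x ^ d b + ∑ l ∈ (Finset.univ.erase a).erase b, σ l * x ^ d l) ^ (m - 1))) <
      max (|(S a).det| * x ^ (m * d a)) (|(S b).det| * x ^ (m * d b))) :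
    ((Matrix.det (∑ l, ((X : ℝ[X]) ^ d l) • (S l).map C)).roots.toFinset.filter
        (fun x => u < x ∧ x < v)).card ≤ m := by
  classical
  -- names
  have hab' : a ≠ b := fun h => by rw [h] at hab; exact lt_irrefl _ hab
  set g : ℕ := d b - d a with hg_def
  have hg : 1 ≤ g := by omega
  have hg0 : (0 : ℝ) < g := by exact_mod_cast hg
  set T : Fin K → Matrix (Fin m) (Fin m) ℂ := fun l => (S l).map (algebraMap ℝ ℂ) with hT_def
  set f : ℝ[X] := Matrix.det (∑ l, ((X : ℝ[X]) ^ d l) • (S l).map C) with hf_def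
  set fC : ℂ[X] := Matrix.det (∑ l, ((X : ℂ[X]) ^ d l) • (T l).map C) with hfC_def
  set G : ℂ[X] := Matrix.det (((X : ℂ[X]) ^ d a) • (T a).map C + ((X : ℂ[X]) ^ d b) • (T b).map C) with hG_def
  set p : ℂ[X] := Matrix.det ((X : ℂ[X]) • (T b).map C + (T a).map C) with hp_def
  set Φ : ℂ → ℂ := fun t => fC.eval (exp t) with hΦ_def
  set Ψ : ℂ → ℂ := fun t => G.eval (exp t) with hΨ_def
  have hfC : f.map (algebraMap ℝ ℂ) = fC := RoucheWindow.map_det_pencil d S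
  -- determinants of the two letters are nonzero
  have hEnonneg : ∀ x : ℝ, 0 ≤ x → 0 ≤ ∑ l ∈ (Finset.univ.erase a).erase b, σ l * x ^ d l :=
    fun x hx => Finset.sum_nonneg fun l _ => mul_nonneg (hσ0 l) (pow_nonneg hx _)
  have hMnonneg : ∀ x : ℝ, 0 ≤ x → 0 ≤ σ a * x ^ d a + σ b * x ^ d b :=
    fun x hx => add_nonneg (mul_nonneg (hσ0 a) (pow_nonneg hx _)) (mul_nonneg (hσ0 b) (pow_nonneg hx _))
  -- generic nonnegativity of the perturbation terms
  have hterm_nonneg : ∀ (x c : ℝ), 0 ≤ x → 0 ≤ c →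
      0 ≤ (m.factorial : ℝ) * (m * (c + ∑ l ∈ (Finset.univ.erase a).erase b, σ l * x ^ d l) *
        (σ a * x ^ d a + σ b * x ^ d b + ∑ l ∈ (Finset.univ.erase a).erase b, σ l * x ^ d l) ^ (m - 1)) :=
    fun x c hx hc => mul_nonneg (Nat.cast_nonneg _) (mul_nonneg (mul_nonneg (Nat.cast_nonneg _)
      (add_nonneg hc (hEnonneg x hx))) (pow_nonneg (add_nonneg (hMnonneg x hx) (hEnonneg x hx)) _))
  have hdetA : (S a).det ≠ 0 := by
    intro h0
    rw [h0, abs_zero, zero_mul] at hleft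
    exact (hterm_nonneg u _ hu.le (mul_nonneg (hσ0 b) (pow_nonneg hu.le _))).not_gt hleft
  have hdetB : (S b).det ≠ 0 := by
    intro h0
    rw [h0, abs_zero, zero_mul] at hright
    exact (hterm_nonneg v _ (by linarith) (mul_nonneg (hσ0 a) (pow_nonneg (by linarith) _))).not_gt hright
  have hTdet : ∀ l, (T l).det = algebraMap ℝ ℂ (S l).det := fun l => by
    rw [RingHom.map_det, RingHom.mapMatrix_apply]
  have hTnorm : ∀ l, ‖(T l).det‖ = |(S l).det| := fun l => by rw [hTdet, norm_algebraMap_real]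
  have hTB : (T b).det ≠ 0 := by rw [hTdet]; exact (_root_.map_ne_zero _).2 hdetB
  have hp0 : p ≠ 0 := by
    intro h0
    have := coeff_det_X_add_C_card (T b) (T a)
    rw [Fintype.card_fin, ← hp_def, h0, coeff_zero] at this
    exact hTB this.symm
  -- the angle
  have hYcard : p.roots.toFinset.card ≤ m :=
    (Multiset.toFinset_card_le _).trans ((card_roots' p).trans (by
      have := natDegree_det_X_add_C_le (T b) (T a); rwa [Fintype.card_fin] at this))
  obtain ⟨θ, hθ1, hθ2, hθsep⟩ := exists_angle_avoiding m p.roots.toFinset hYcard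
  set δ : ℝ := π / (2 * (m + 1)) with hδ_def
  have hδ0 : 0 < δ := by positivity
  have hδ2 : δ ≤ π / 2 := div_le_div_of_nonneg_left Real.pi_pos.le two_pos (by
    have : (0 : ℝ) ≤ m := Nat.cast_nonneg m
    linarith)
  have hθπ : θ < π := by linarith
  have hθ0 : 0 < θ := by linarith
  set h : ℝ := θ / g with hh_def
  have hh0 : 0 < h := div_pos hθ0 hg0
  have hhg : h ≤ π / g := by rw [hh_def]; exact div_le_div_of_nonneg_right hθπ.le hg0.le
  have hgh : (g : ℝ) * h = θ := by rw [hh_def]; field_simp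
  -- the rectangle
  set t₁ : ℝ := Real.log u with ht₁
  set t₂ : ℝ := Real.log v with ht₂
  have ht : t₁ < t₂ := Real.log_lt_log hu huv
  have hexp_mem : ∀ τ ∈ Set.Icc t₁ t₂, Real.exp τ ∈ Set.Icc u v := by
    intro τ hτ
    constructor
    · calc u = Real.exp t₁ := (Real.exp_log hu).symm
        _ ≤ Real.exp τ := Real.exp_le_exp.2 hτ.1
    · calc Real.exp τ ≤ Real.exp t₂ := Real.exp_le_exp.2 hτ.2
        _ = v := Real.exp_log (by linarith)
  -- pointwise estimates
  have normexp : ∀ t : ℂ, ‖exp t‖ = Real.exp t.re := fun t => Complex.norm_exp t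
  have hU : ∀ t : ℂ, ‖Φ t - Ψ t‖ ≤ (m.factorial : ℝ) * (m *
      (∑ l ∈ (Finset.univ.erase a).erase b, σ l * Real.exp t.re ^ d l) *
      (σ a * Real.exp t.re ^ d a + σ b * Real.exp t.re ^ d b +
        ∑ l ∈ (Finset.univ.erase a).erase b, σ l * Real.exp t.re ^ d l) ^ (m - 1)) := by
    intro t
    have := norm_det_sub_two_le d S σ hσ hσ0 hab' (exp t)
    rw [normexp] at this
    rw [hΦ_def, hΨ_def]
    simp only
    rw [hfC_def, hG_def, RoucheWindow.eval_det_pencil, RoucheWindow.eval_det_twoLetter]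
    exact this
  have hVl : ∀ t : ℂ, |(S a).det| * Real.exp t.re ^ (m * d a) - (m.factorial : ℝ) * (m *
      (σ b * Real.exp t.re ^ d b) * (σ a * Real.exp t.re ^ d a + σ b * Real.exp t.re ^ d b) ^ (m - 1)) ≤
      ‖Ψ t‖ := by
    intro t
    have := norm_det_two_ge d S σ hσ hσ0 a b (exp t)
    rw [normexp] at this
    rw [hΨ_def]; simp only; rw [hG_def, RoucheWindow.eval_det_twoLetter]
    exact this
  have hVr : ∀ t : ℂ, |(S b).det| * Real.exp t.re ^ (m * d b) - (m.factorial : ℝ) * (m *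
      (σ a * Real.exp t.re ^ d a) * (σ b * Real.exp t.re ^ d b + σ a * Real.exp t.re ^ d a) ^ (m - 1)) ≤
      ‖Ψ t‖ := by
    intro t
    have := norm_det_two_ge d S σ hσ hσ0 b a (exp t)
    rw [normexp, add_comm ((exp t) ^ d b • T b)] at this
    rw [hΨ_def]; simp only; rw [hG_def, RoucheWindow.eval_det_twoLetter]
    exact this
  have hH : ∀ (τ s : ℝ), (s = 1 ∨ s = -1) →
      Real.sin δ ^ m * max (|(S b).det| * Real.exp τ ^ (m * d b)) (|(S a).det| * Real.exp τ ^ (m * d a)) ≤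
        ‖Ψ ((τ : ℂ) + ((s * h : ℝ) : ℂ) * I)‖ := by
    intro τ s hs
    have hsep' : ∀ y ∈ p.roots, δ ≤ |θ - abs (arg y)| := fun y hy => hθsep y (Multiset.mem_toFinset.2 hy)
    have hray := eval_norm_ge_on_ray (T a) (T b) hTB (r := Real.exp τ ^ g) (θ := θ) (pow_pos (Real.exp_pos τ) g)
      hδ0.le hδ2 hθ1 hθ2 hθπ hsep' s hs
    -- rewrite `Ψ` at the point
    have hpt : exp (((g : ℕ) : ℂ) * ((τ : ℂ) + ((s * h : ℝ) : ℂ) * I)) =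
        ((Real.exp τ ^ g : ℝ) : ℂ) * exp ((s * θ : ℝ) * I) := by
      have e1 : ((g : ℕ) : ℂ) * ((τ : ℂ) + ((s * h : ℝ) : ℂ) * I) =
          ((g : ℕ) : ℂ) * (τ : ℂ) + (((g : ℝ) * (s * h) : ℝ) : ℂ) * I := by push_cast; ring
      rw [e1, Complex.exp_add, Complex.exp_nat_mul, ← Complex.ofReal_exp, ← Complex.ofReal_pow]
      congr 3
      rw [← hgh]; ring
    have hΨt : Ψ ((τ : ℂ) + ((s * h : ℝ) : ℂ) * I) = exp ((τ : ℂ) + ((s * h : ℝ) : ℂ) * I) ^ (d a * m) *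
        p.eval (((Real.exp τ ^ g : ℝ) : ℂ) * exp ((s * θ : ℝ) * I)) := by
      rw [hΨ_def]; simp only; rw [hG_def, twoLetter_exp_eq hab, ← hg_def, hpt]
    have hnexp : ‖exp ((τ : ℂ) + ((s * h : ℝ) : ℂ) * I)‖ = Real.exp τ := by
      rw [normexp]; simp
    rw [hΨt, norm_mul, norm_pow, hnexp, hTnorm, hTnorm] at *
    have hx0 : 0 ≤ Real.exp τ ^ (d a * m) := pow_nonneg (Real.exp_pos τ).le _
    have key := mul_le_mul_of_nonneg_left hray hx0
    have e2 : Real.exp τ ^ (d a * m) * (Real.sin δ ^ m * max (|(S b).det| * (Real.exp τ ^ g) ^ m) |(S a).det|) =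
        Real.sin δ ^ m * max (|(S b).det| * Real.exp τ ^ (m * d b)) (|(S a).det| * Real.exp τ ^ (m * d a)) := by
      rw [mul_left_comm, mul_max_of_nonneg _ _ hx0]
      congr 2
      · rw [← pow_mul, mul_left_comm, ← pow_add]; congr 1; rw [hg_def]
        have : d a + (d b - d a) = d b := by omega
        rw [show d a * m + (d b - d a) * m = (d a + (d b - d a)) * m by ring, this, mul_comm]
      · rw [mul_comm, mul_comm (d a) m]
    rw [e2] at key
    exact key
  -- the boundary inequalities
  have hsin := inv_pow_le_sin_pow m
  rw [← hδ_def] at hsin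
  have hPpos : (0 : ℝ) < ((m : ℝ) + 1) ^ m := by positivity
  have horiz : ∀ (τ : ℝ), τ ∈ Set.Icc t₁ t₂ → ∀ (s : ℝ), (s = 1 ∨ s = -1) →
      ‖Φ ((τ : ℂ) + ((s * h : ℝ) : ℂ) * I) - Ψ ((τ : ℂ) + ((s * h : ℝ) : ℂ) * I)‖ <
        ‖Ψ ((τ : ℂ) + ((s * h : ℝ) : ℂ) * I)‖ := by
    intro τ hτ s hs
    set x : ℝ := Real.exp τ with hx_def
    have hx : x ∈ Set.Icc u v := hexp_mem τ hτ
    have hre : ((τ : ℂ) + ((s * h : ℝ) : ℂ) * I).re = τ := by simp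
    have h1 := hU ((τ : ℂ) + ((s * h : ℝ) : ℂ) * I)
    rw [hre, ← hx_def] at h1
    have h2 := hH τ s hs
    rw [← hx_def] at h2
    have h3 := hwin x hx
    have hMax0 : 0 ≤ max (|(S a).det| * x ^ (m * d a)) (|(S b).det| * x ^ (m * d b)) :=
      le_max_of_le_left (mul_nonneg (abs_nonneg _) (pow_nonneg (Real.exp_pos τ).le _))
    rw [max_comm] at h2
    have h4 : (m.factorial : ℝ) * (m * (∑ l ∈ (Finset.univ.erase a).erase b, σ l * x ^ d l) *
        (σ a * x ^ d a + σ b * x ^ d b + ∑ l ∈ (Finset.univ.erase a).erase b, σ l * x ^ d l) ^ (m - 1)) <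
        (((m : ℝ) + 1) ^ m)⁻¹ * max (|(S a).det| * x ^ (m * d a)) (|(S b).det| * x ^ (m * d b)) := by
      rw [← div_eq_inv_mul, lt_div_iff₀ hPpos, mul_comm]
      exact h3
    have h5 : (((m : ℝ) + 1) ^ m)⁻¹ * max (|(S a).det| * x ^ (m * d a)) (|(S b).det| * x ^ (m * d b)) ≤
        Real.sin δ ^ m * max (|(S a).det| * x ^ (m * d a)) (|(S b).det| * x ^ (m * d b)) :=
      mul_le_mul_of_nonneg_right hsin hMax0
    linarith
  have h_bot : ∀ τ ∈ Set.Icc t₁ t₂, ‖Φ ((τ : ℂ) + ((-h : ℝ) : ℂ) * I) - Ψ ((τ : ℂ) + ((-h : ℝ) : ℂ) * I)‖ <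
      ‖Ψ ((τ : ℂ) + ((-h : ℝ) : ℂ) * I)‖ := by
    intro τ hτ
    have := horiz τ hτ (-1) (Or.inr rfl)
    rwa [show ((-1 : ℝ) * h) = -h by ring] at this
  have h_top : ∀ τ ∈ Set.Icc t₁ t₂, ‖Φ ((τ : ℂ) + ((h : ℝ) : ℂ) * I) - Ψ ((τ : ℂ) + ((h : ℝ) : ℂ) * I)‖ <
      ‖Ψ ((τ : ℂ) + ((h : ℝ) : ℂ) * I)‖ := by
    intro τ hτ
    have := horiz τ hτ 1 (Or.inl rfl)
    rwa [show ((1 : ℝ) * h) = h by ring] at this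
  have h_left : ∀ y ∈ Set.Icc (-h) h, ‖Φ ((t₁ : ℂ) + (y : ℂ) * I) - Ψ ((t₁ : ℂ) + (y : ℂ) * I)‖ <
      ‖Ψ ((t₁ : ℂ) + (y : ℂ) * I)‖ := by
    intro y hy
    have hre : ((t₁ : ℂ) + (y : ℂ) * I).re = t₁ := by simp
    have h1 := hU ((t₁ : ℂ) + (y : ℂ) * I)
    have h2 := hVl ((t₁ : ℂ) + (y : ℂ) * I)
    rw [hre, ht₁, Real.exp_log hu] at h1 h2
    have hmono : (σ a * u ^ d a + σ b * u ^ d b) ^ (m - 1) ≤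
        (σ a * u ^ d a + σ b * u ^ d b + ∑ l ∈ (Finset.univ.erase a).erase b, σ l * u ^ d l) ^ (m - 1) :=
      pow_le_pow_left₀ (hMnonneg u hu.le) (le_add_of_nonneg_right (hEnonneg u hu.le)) _
    have h3 : (m.factorial : ℝ) * (m * (σ b * u ^ d b) * (σ a * u ^ d a + σ b * u ^ d b) ^ (m - 1)) ≤
        (m.factorial : ℝ) * (m * (σ b * u ^ d b) *
          (σ a * u ^ d a + σ b * u ^ d b + ∑ l ∈ (Finset.univ.erase a).erase b, σ l * u ^ d l) ^ (m - 1)) :=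
      mul_le_mul_of_nonneg_left (mul_le_mul_of_nonneg_left hmono
        (mul_nonneg (Nat.cast_nonneg _) (mul_nonneg (hσ0 b) (pow_nonneg hu.le _)))) (Nat.cast_nonneg _)
    have h4 : (m.factorial : ℝ) * (m * (σ b * u ^ d b + ∑ l ∈ (Finset.univ.erase a).erase b, σ l * u ^ d l) *
        (σ a * u ^ d a + σ b * u ^ d b + ∑ l ∈ (Finset.univ.erase a).erase b, σ l * u ^ d l) ^ (m - 1)) =
        (m.factorial : ℝ) * (m * (σ b * u ^ d b) *
          (σ a * u ^ d a + σ b * u ^ d b + ∑ l ∈ (Finset.univ.erase a).erase b, σ l * u ^ d l) ^ (m - 1)) +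
        (m.factorial : ℝ) * (m * (∑ l ∈ (Finset.univ.erase a).erase b, σ l * u ^ d l) *
          (σ a * u ^ d a + σ b * u ^ d b + ∑ l ∈ (Finset.univ.erase a).erase b, σ l * u ^ d l) ^ (m - 1)) := by
      ring
    linarith
  have h_right : ∀ y ∈ Set.Icc (-h) h, ‖Φ ((t₂ : ℂ) + (y : ℂ) * I) - Ψ ((t₂ : ℂ) + (y : ℂ) * I)‖ <
      ‖Ψ ((t₂ : ℂ) + (y : ℂ) * I)‖ := by
    intro y hy
    have hv : 0 < v := by linarith
    have hre : ((t₂ : ℂ) + (y : ℂ) * I).re = t₂ := by simp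
    have h1 := hU ((t₂ : ℂ) + (y : ℂ) * I)
    have h2 := hVr ((t₂ : ℂ) + (y : ℂ) * I)
    rw [hre, ht₂, Real.exp_log hv] at h1 h2
    have hmono : (σ b * v ^ d b + σ a * v ^ d a) ^ (m - 1) ≤
        (σ a * v ^ d a + σ b * v ^ d b + ∑ l ∈ (Finset.univ.erase a).erase b, σ l * v ^ d l) ^ (m - 1) := by
      rw [add_comm (σ b * v ^ d b)]
      exact pow_le_pow_left₀ (hMnonneg v hv.le) (le_add_of_nonneg_right (hEnonneg v hv.le)) _
    have h3 : (m.factorial : ℝ) * (m * (σ a * v ^ d a) * (σ b * v ^ d b + σ a * v ^ d a) ^ (m - 1)) ≤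
        (m.factorial : ℝ) * (m * (σ a * v ^ d a) *
          (σ a * v ^ d a + σ b * v ^ d b + ∑ l ∈ (Finset.univ.erase a).erase b, σ l * v ^ d l) ^ (m - 1)) :=
      mul_le_mul_of_nonneg_left (mul_le_mul_of_nonneg_left hmono
        (mul_nonneg (Nat.cast_nonneg _) (mul_nonneg (hσ0 a) (pow_nonneg hv.le _)))) (Nat.cast_nonneg _)
    have h4 : (m.factorial : ℝ) * (m * (σ a * v ^ d a + ∑ l ∈ (Finset.univ.erase a).erase b, σ l * v ^ d l) *
        (σ a * v ^ d a + σ b * v ^ d b + ∑ l ∈ (Finset.univ.erase a).erase b, σ l * v ^ d l) ^ (m - 1)) =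
        (m.factorial : ℝ) * (m * (σ a * v ^ d a) *
          (σ a * v ^ d a + σ b * v ^ d b + ∑ l ∈ (Finset.univ.erase a).erase b, σ l * v ^ d l) ^ (m - 1)) +
        (m.factorial : ℝ) * (m * (∑ l ∈ (Finset.univ.erase a).erase b, σ l * v ^ d l) *
          (σ a * v ^ d a + σ b * v ^ d b + ∑ l ∈ (Finset.univ.erase a).erase b, σ l * v ^ d l) ^ (m - 1)) := by
      ring
    linarith
  -- analyticity
  have hΦd : Differentiable ℂ Φ := (Polynomial.differentiable fC).comp Complex.differentiable_exp
  have hΨd : Differentiable ℂ Ψ := (Polynomial.differentiable G).comp Complex.differentiable_exp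
  have hΦan : AnalyticOnNhd ℂ Φ (Set.Icc t₁ t₂ ×ℂ Set.Icc (-h) h) := fun z _ => hΦd.analyticAt z
  have hΨan : AnalyticOnNhd ℂ Ψ (Set.Icc t₁ t₂ ×ℂ Set.Icc (-h) h) := fun z _ => hΨd.analyticAt z
  have hhh : -h < h := by linarith
  -- Rouché on the rectangle
  have hR := finsum_order_eq_of_norm_sub_lt_rect ht hhh hΦan hΨan h_bot h_top h_left h_right
  -- a boundary point where nothing vanishes
  have hw₀K : ((t₁ : ℂ) + ((-h : ℝ) : ℂ) * I) ∈ Set.Icc t₁ t₂ ×ℂ Set.Icc (-h) h :=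
    ⟨by simpa using ht.le, by simpa using hhh.le⟩
  obtain ⟨hΨw₀, hΦw₀, -⟩ := aux_of_norm_sub_lt (h_bot t₁ ⟨le_rfl, ht.le⟩)
  rw [finsum_order_eq_natCast ht.le hhh.le hΦan hw₀K hΦw₀,
    finsum_order_eq_natCast ht.le hhh.le hΨan hw₀K hΨw₀] at hR
  have hN := Nat.cast_injective (R := ℂ) hR
  -- the count for Ψ
  set TΨ := (Literature.Analysis.Complex.finite_zeros_reProdIm ht.le hhh.le hΨan hw₀K hΨw₀).toFinset with hTΨ
  have hNΨ : ∑ ρ ∈ TΨ, analyticOrderNatAt Ψ ρ ≤ m := by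
    refine sum_analyticOrderNatAt_twoLetter_exp_le hab (T a) (T b) hp0 hhg TΨ fun ρ hρ => ?_
    rw [hTΨ, Set.Finite.mem_toFinset] at hρ
    obtain ⟨hρ0, -, hρim⟩ := hρ
    exact ⟨abs_lt.2 ⟨by simpa using hρim.1, by simpa using hρim.2⟩, hρ0⟩
  -- the count for Φ
  set TΦ := (Literature.Analysis.Complex.finite_zeros_reProdIm ht.le hhh.le hΦan hw₀K hΦw₀).toFinset with hTΦ
  have hf0 : f ≠ 0 := by
    intro h0
    apply hΦw₀
    rw [hΦ_def]; simp only; rw [← hfC, h0, Polynomial.map_zero, eval_zero]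
  set W := f.roots.toFinset.filter (fun x => u < x ∧ x < v) with hW
  set ι : ℝ → ℂ := fun x => ((Real.log x : ℝ) : ℂ) with hι
  have hWpos : ∀ x ∈ W, 0 < x := by
    intro x hx
    rw [hW, Finset.mem_filter] at hx
    linarith [hx.2.1]
  have hιmem : ∀ x ∈ W, ι x ∈ TΦ := by
    intro x hx
    have hx0 := hWpos x hx
    rw [hW, Finset.mem_filter, Multiset.mem_toFinset, mem_roots hf0] at hx
    rw [hTΦ, Set.Finite.mem_toFinset]
    refine ⟨?_, ⟨?_, ?_⟩, ?_, ?_⟩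
    · rw [hΦ_def]; simp only
      rw [hι]; simp only
      rw [← Complex.ofReal_exp, Real.exp_log hx0, ← hfC, RoucheWindow.eval_map_ofReal, hx.1.eq_zero,
        Complex.ofReal_zero]
    · simpa [hι, ht₁] using Real.log_lt_log hu hx.2.1
    · simpa [hι, ht₂] using Real.log_lt_log hx0 hx.2.2
    · simpa [hι] using hh0
    · simpa [hι] using hh0
  have hιinj : Set.InjOn ι W := by
    intro x hx y hy hxy
    have := Complex.ofReal_injective hxy
    exact Real.log_injOn_pos (hWpos x hx) (hWpos y hy) this
  have hWle : W.card ≤ ∑ ρ ∈ TΦ, analyticOrderNatAt Φ ρ := by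
    calc W.card = (W.image ι).card := (Finset.card_image_of_injOn hιinj).symm
      _ = ∑ _ρ ∈ W.image ι, 1 := Finset.card_eq_sum_ones _
      _ ≤ ∑ ρ ∈ W.image ι, analyticOrderNatAt Φ ρ := by
          refine Finset.sum_le_sum fun ρ hρ => ?_
          obtain ⟨x, hx, rfl⟩ := Finset.mem_image.1 hρ
          have hmem := hιmem x hx
          rw [hTΦ, Set.Finite.mem_toFinset] at hmem
          exact one_le_analyticOrderNatAt ht.le hhh.le hΦan hw₀K hΦw₀
            ⟨Set.Ioo_subset_Icc_self hmem.2.1, Set.Ioo_subset_Icc_self hmem.2.2⟩ hmem.1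
      _ ≤ ∑ ρ ∈ TΦ, analyticOrderNatAt Φ ρ :=
          Finset.sum_le_sum_of_subset_of_nonneg (fun ρ hρ => by
            obtain ⟨x, hx, rfl⟩ := Finset.mem_image.1 hρ; exact hιmem x hx) fun _ _ _ => Nat.zero_le _
  calc W.card ≤ ∑ ρ ∈ TΦ, analyticOrderNatAt Φ ρ := hWle
    _ = ∑ ρ ∈ TΨ, analyticOrderNatAt Ψ ρ := hN
    _ ≤ m := hNΨ

end Window

end Summit.ValiantsHypothesis.ValiantsHypothesis.Theorems.LacunarySymmetroidMatrixDescartes.Separated
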